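import Literature.NumberTheory.LFunctions.LogIntegralProofs
import HarnessLib

/-!
# Discharges of the `Li` facts of `LogIntegral.lean`: `Li' x = 1 / log x` and `Li x ∼ x / log x`

D-0014 keeps `Literature/` sorry-free by stating cited results as named facts `def X : Prop`.
This sibling file of `Literature.NumberTheory.LFunctions.LogIntegral` proves the two named facts
about the offset (Eulerian) logarithmic integral
`Li x = ∫₂ˣ dt / log t = Literature.NumberTheory.LFunctions.offsetLogIntegral x` that were still
undischarged:

* `Literature.NumberTheory.LFunctions.hasDerivAt_offsetLogIntegral` — `Li` has derivative
  `(log x)⁻¹` at every `x > 1` — as `theorem hasDerivAt_offsetLogIntegral_holds`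
  (with the pointwise forms `deriv_offsetLogIntegral`, `differentiableOn_offsetLogIntegral`,
  `continuousOn_offsetLogIntegral`);
* `Literature.NumberTheory.LFunctions.isEquivalent_offsetLogIntegral` — `Li x ∼ x / log x` as
  `x → ∞` — as `theorem isEquivalent_offsetLogIntegral_holds`.

Users holding `(h : hasDerivAt_offsetLogIntegral)` / `(h : isEquivalent_offsetLogIntegral)` are
fed the `_holds` theorems. Both are the case `k = 1` of the `Li_k` results of
`Literature.NumberTheory.LFunctions.LogIntegralProofs`
(`hasDerivAt_offsetLogIntegralPow_holds`: first fundamental theorem of calculus for the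
integrand `t ↦ (log t)⁻¹ ^ k`, continuous on the open set `(1, ∞)`;
`isEquivalent_offsetLogIntegralPow_holds`: one integration by parts), transported along
`offsetLogIntegralPow_one : offsetLogIntegralPow 1 = offsetLogIntegral`. No new definitions, no
new named facts.

## Sources

The two named facts carry the locator "Schoenfeld 1976, §1". Schoenfeld's Part II (Math. Comp.
30 (1976), 337–360) continues the section numbering of Rosser–Schoenfeld 1975 (Part I) and
opens with §6 — p. 337: "We use the references and continue the paragraph numbering of the
original paper by Rosser and Schoenfeld [11] and adhere to the same notations" — so there is no
§1 in it; its `li` (Theorem 10 and Corollary 1, (6.18)–(6.19), p. 339: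
`|π(x) − li(x)| < √x log x / (8π)` for `x ≥ 2657` under RH) is the `li` of Rosser–Schoenfeld
1962, (2.15)–(2.17), p. 66: `li(x) = Ei(log x)` (principal value) and
`∫₂ˣ dy / log y = li(x) − li(2)`, the right-hand side of (2.17) being the offset integral `Li`
of this tree; `d li(y) = dy / log y` on `[2, x]` is used in the proof of Corollary 2, (6.21),
p. 340. The statements themselves are printed, for `li(x) := ∫₂ˣ dt/log t` (our `Li`), in
Jameson, *The Prime Number Theorem* (2003), §1.5: p. 26, "by the fundamental theorem of
calculus, the derivative of li(x) (for x ≥ 2) is 1/log x", and Proposition 1.5.3, p. 27,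
"li(x) ∼ x/log x as x → ∞" (from (1.5)–(1.7) and Proposition 1.5.2, one integration by parts;
cf. Rosser–Schoenfeld 1962, (2.18), p. 66, "two terms of the asymptotic expansion for li(x)").

## References

* L. Schoenfeld, *Sharper bounds for the Chebyshev functions θ(x) and ψ(x). II*, Math. Comp. 30
  (1976), no. 134, 337–360: §6, Theorem 10, Corollary 1 (6.18)–(6.19) p. 339, Corollary 2
  (6.21) p. 340. [cite: Schoenfeld1976]
* J. B. Rosser, L. Schoenfeld, *Approximate formulas for some functions of prime numbers*,
  Illinois J. Math. 6 (1962), 64–94: (2.15)–(2.18), p. 66. [cite: RosserSchoenfeld1962]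
* G. J. O. Jameson, *The Prime Number Theorem*, LMS Student Texts 53, Cambridge University
  Press (2003), §1.5: p. 26 (definition of `li`, derivative `1/log x`), (1.5)–(1.7),
  Prop. 1.5.2, Prop. 1.5.3 (pp. 26–27). [cite: Jameson2003]
-/

noncomputable section

open Real Filter Asymptotics Set
open scoped Topology

namespace Literature.NumberTheory.LFunctions

section HasDerivAtOffsetLogIntegral

/-- **Discharge of `hasDerivAt_offsetLogIntegral`**: `Li = ∫₂^· dt/log t` has derivative
`(log x)⁻¹` at every `x > 1` — the first fundamental theorem of calculus
(`intervalIntegral.integral_hasDerivAt_right`) for the integrand `t ↦ (log t)⁻¹`, continuous on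
the open set `(1, ∞) ∋ 2, x`; here the case `k = 1` of `hasDerivAt_offsetLogIntegralPow_holds`
along `offsetLogIntegralPow_one`. Printed for `li(x) := ∫₂ˣ dt/log t` in Jameson 2003, §1.5,
p. 26 ("by the fundamental theorem of calculus, the derivative of li(x) is 1/log x");
Schoenfeld 1976 works with `li` in the notation of Rosser–Schoenfeld 1962, (2.17), p. 66
(`∫₂ˣ dy/log y = li(x) − li(2)`), and uses `d li(y) = dy/log y` on `[2, x]` in the proof of
Corollary 2, (6.21), p. 340.
[cite: Schoenfeld1976, §6 Cor. 2 (6.21) proof p. 340; Jameson2003 §1.5 p. 26; RosserSchoenfeld1962 (2.17) p. 66] -/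
theorem hasDerivAt_offsetLogIntegral_holds : hasDerivAt_offsetLogIntegral := by
  intro x hx
  have h := hasDerivAt_offsetLogIntegralPow_holds 1 hx
  rw [offsetLogIntegralPow_one, pow_one] at h
  exact h

/-- Pointwise form of `hasDerivAt_offsetLogIntegral_holds`: `deriv Li x = (log x)⁻¹` for `x > 1`
(Jameson 2003, §1.5, p. 26). [cite: Jameson2003, §1.5 p. 26] -/
theorem deriv_offsetLogIntegral {x : ℝ} (hx : 1 < x) :
    deriv offsetLogIntegral x = (Real.log x)⁻¹ :=
  (hasDerivAt_offsetLogIntegral_holds hx).deriv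

/-- `Li` is differentiable on `(1, ∞)` (Jameson 2003, §1.5, p. 26). [cite: Jameson2003, §1.5 p. 26] -/
theorem differentiableOn_offsetLogIntegral : DifferentiableOn ℝ offsetLogIntegral (Ioi 1) :=
  fun _ hx => (hasDerivAt_offsetLogIntegral_holds hx).differentiableAt.differentiableWithinAt

/-- `Li` is continuous on `(1, ∞)` (it is differentiable there; Jameson 2003, §1.5, p. 26).
[cite: Jameson2003, §1.5 p. 26] -/
theorem continuousOn_offsetLogIntegral : ContinuousOn offsetLogIntegral (Ioi 1) :=
  differentiableOn_offsetLogIntegral.continuousOn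

end HasDerivAtOffsetLogIntegral

section IsEquivalentOffsetLogIntegral

/-- **Discharge of `isEquivalent_offsetLogIntegral`**: `Li x ∼ x / log x` as `x → ∞` —
Jameson 2003, Proposition 1.5.3, p. 27 ("li(x) ∼ x/log x", with `li(x) := ∫₂ˣ dt/log t`, from
one integration by parts (1.5)–(1.7) and Proposition 1.5.2); here the case `k = 1` of
`isEquivalent_offsetLogIntegralPow_holds` along `offsetLogIntegralPow_one`. Rosser–Schoenfeld
1962, (2.17)–(2.18), p. 66, use "two terms of the asymptotic expansion for li(x)" for the same
`∫₂ˣ dy/log y = li(x) − li(2)`, the `li` of Schoenfeld 1976.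
[cite: Jameson2003, Prop. 1.5.3 p. 27; RosserSchoenfeld1962 (2.17)–(2.18) p. 66; Schoenfeld1976 §6 (notation of Part I)] -/
theorem isEquivalent_offsetLogIntegral_holds : isEquivalent_offsetLogIntegral := by
  show offsetLogIntegral ~[atTop] fun x => x / Real.log x
  have h := isEquivalent_offsetLogIntegralPow_holds 1
  rw [offsetLogIntegralPow_one] at h
  simpa using h

end IsEquivalentOffsetLogIntegral

end Literature.NumberTheory.LFunctions
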